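import Summits.QuantumAdvantage.QuantumAdvantage.Theorems.SoloInformedPsdCounting
import Literature.Computability.Complexity.NisanRandomizedLowerBound
import HarnessLib

/-!
# The classical doors are black-box shut too: pseudo-deterministic RANDOMISED cost of approximate majority

Solo seat `solo-QuantumAdvantage-informed`, session 3, file 17; companion of files 14
(`SoloInformedQueryLift`), 16 (`SoloInformedPsdCounting`) and of the Literature reproduction
`NisanRandomizedLowerBound` (Nisan 1991: `bs(f) ≤ 3 R₂(f)`, `D(f) ≤ 27 R₂(f)³`).

The seat's three doors are canonisation statements — C-EXT' (`pr-BPP ⊆ PromiseBPP`: classical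
algorithms canonise classical acceptance probabilities; Dixon–Pavan–Vander Woude–Vinodchandran),
H₀ (`pr-BPP ⊆ promiseLift BQP`: quantum algorithms canonise classical ones) and Q-EXT
(`PromiseBQP ⊆ promiseLift BQP`: quantum algorithms canonise quantum ones). File 16 showed the
quantum canonisers cannot be black-box (approximate majority: `R₂ = Q₂ ≤ 1` on the promise but
`psdQ₂ > (N/12288)^{1/6}`). This file adds the classical canoniser (C-EXT'), using Nisan's cubic
relation in place of Beals et al.'s sixth power:

* `psdRandQueryComplexity ε D P` — least `R_ε` of a completion (pseudo-deterministic randomised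
  query complexity; Goldreich–Goldwasser–Ron 2013, Goldwasser–Impagliazzo–Pitassi–Santhanam 2021);
  `R_ε(P on D) ≤ psdR_ε ≤ R_ε(P)`, `psdQ_ε ≤ psdR_ε`.
* `detQueryComplexityOn_le_psdRand_pow_three : D(P on D) ≤ 27 · psdR₂(D,P)³` (Nisan pulled back to
  the promise): classical pseudo-determinism buys at most a cubic saving over DETERMINISM.
* `gapMaj_psdRand_gap (1 ≤ N) : R₂(GapMaj_N) ≤ 1 ∧ N < 81 · psdR₂(GapMaj_N)³` — the decision form,
  with explicit constant, of Goldreich–Goldwasser–Ron's `Ω(N)` pseudo-deterministic lower bound for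
  Hamming-weight estimation [GIPS2021 p. 36:18]; `not_psdRandPolyBounded`.
* `gapMaj_three_doors (1 ≤ N)`: at approximate majority all three canonisations are black-box
  impossible at once: `R₂ ≤ 1`, `Q₂ ≤ 1`, `81·psdR₂³ > N`, `12288·psdQ₂⁶ > N`.

**Reading.** White-box, the classical doors are rescued by advice (file 15: C-EXT'/poly, H₀/poly are
theorems) and by pseudorandom generators (file 10: hardness ⇒ C-EXT); the black-box obstruction is
the same for all three doors, so what singles out the quantum door is only the absence of a
white-box canoniser for measurement outcomes.

## References
* [Nisan1991] N. Nisan, *CREW PRAMs and decision trees*, SIAM J. Comput. 20 (1991); Buhrman–de Wolf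
  2002 Thm 16 / Cor 3 [galaxy: pdf:-6514774275231728200 p.14] (tree:
  `blockSensitivity_le_three_mul_randQueryComplexity`, `detQueryComplexity_le_27_mul_randQueryComplexity_pow_three`).
* [GIPS2021] Goldwasser–Impagliazzo–Pitassi–Santhanam, CCC 2021, p. 36:18 (GGR13's `Ω(n)`)
  [corpus: paper:doi-10-4230-lipics-ccc-2021-36 p.18].
* [GGR2013] O. Goldreich, S. Goldwasser, D. Ron, ITCS 2013.
-/

noncomputable section

namespace Summit.QuantumAdvantage.QuantumAdvantage.Theorems

open Finset Literature.Computability.Complexity Literature.Computability.Cryptography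
  Literature.Computability.QuantumComplexity Literature.Barriers.QuantumAdvantage

variable {N : ℕ}

/-! ### Pseudo-deterministic randomised query complexity -/

/-- The **pseudo-deterministic randomised query complexity** of the promise problem `(D, P)` with
error `ε`: the least `R_ε` of a completion of `P` (a randomised algorithm outputting one canonical
bit with probability `≥ 1 - ε` on every input, correct on the promise).
[cite: GIPS2021, §1 (p. 36:4)] -/
def psdRandQueryComplexity (ε : ℝ) (D : Set (Fin N → Bool)) (P : (Fin N → Bool) → Bool) : ℕ :=
  sInf {T | ∃ f ∈ completions D P, randQueryComplexity ε f = T}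

/-- The defining set is nonempty (`P` completes itself). [folklore] -/
theorem psdRandQueryComplexity_set_nonempty (ε : ℝ) (D : Set (Fin N → Bool))
    (P : (Fin N → Bool) → Bool) :
    {T | ∃ f ∈ completions D P, randQueryComplexity ε f = T}.Nonempty :=
  ⟨_, P, self_mem_completions D P, rfl⟩

/-- `psdR_ε` is attained by some completion. [folklore] -/
theorem exists_mem_completions_eq_psdRand (ε : ℝ) (D : Set (Fin N → Bool))
    (P : (Fin N → Bool) → Bool) :
    ∃ f ∈ completions D P, randQueryComplexity ε f = psdRandQueryComplexity ε D P :=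
  Nat.sInf_mem (psdRandQueryComplexity_set_nonempty ε D P)

/-- Every completion bounds `psdR_ε` from above. [folklore] -/
theorem psdRandQueryComplexity_le {ε : ℝ} {D : Set (Fin N → Bool)}
    {P f : (Fin N → Bool) → Bool} (hf : f ∈ completions D P) :
    psdRandQueryComplexity ε D P ≤ randQueryComplexity ε f :=
  Nat.sInf_le ⟨f, hf, rfl⟩

/-- `psdR_ε(D,P) ≤ R_ε(P)`. [folklore] -/
theorem psdRandQueryComplexity_le_self (ε : ℝ) (D : Set (Fin N → Bool))
    (P : (Fin N → Bool) → Bool) :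
    psdRandQueryComplexity ε D P ≤ randQueryComplexity ε P :=
  psdRandQueryComplexity_le (self_mem_completions D P)

/-- Restricting the success requirement to a sub-domain only helps: `R_ε(f on D) ≤ R_ε(f)`
(`0 ≤ ε`). [cite: Wolf2002, §2.2] -/
theorem randQueryComplexityOn_le_randQueryComplexity {ε : ℝ} (hε : 0 ≤ ε)
    (D : Set (Fin N → Bool)) (f : (Fin N → Bool) → Bool) :
    randQueryComplexityOn ε D f ≤ randQueryComplexity ε f := by
  obtain ⟨μ, hd, hμ⟩ := exists_pmf_randQueryComplexity hε f
  exact Nat.sInf_le ⟨μ, hd, fun x _ => hμ x⟩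

/-- `R_ε(P on D) ≤ psdR_ε(D, P)` (`0 ≤ ε`): a pseudo-deterministic algorithm is in particular a
bounded-error algorithm on the promise. [cite: GIPS2021, §1 (p. 36:4)] -/
theorem randQueryComplexityOn_le_psdRand {ε : ℝ} (hε : 0 ≤ ε) (D : Set (Fin N → Bool))
    (P : (Fin N → Bool) → Bool) :
    randQueryComplexityOn ε D P ≤ psdRandQueryComplexity ε D P := by
  obtain ⟨f, hf, hq⟩ := exists_mem_completions_eq_psdRand ε D P
  rw [← hq, ← randQueryComplexityOn_congr ε hf]
  exact randQueryComplexityOn_le_randQueryComplexity hε D f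

/-- `psdQ_ε ≤ psdR_ε` (`0 ≤ ε`): quantum algorithms simulate randomised ones completion by
completion (tree: `quantumQueryComplexity_le_randQueryComplexity_of_nonneg`).
[cite: Wolf2002, §3.3] -/
theorem psdQuantum_le_psdRand {ε : ℝ} (hε : 0 ≤ ε) (D : Set (Fin N → Bool))
    (P : (Fin N → Bool) → Bool) :
    psdQuantumQueryComplexity ε D P ≤ psdRandQueryComplexity ε D P := by
  obtain ⟨f, hf, hq⟩ := exists_mem_completions_eq_psdRand ε D P
  rw [← hq]
  exact (psdQuantumQueryComplexity_le hf).trans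
    (quantumQueryComplexity_le_randQueryComplexity_of_nonneg hε f)

/-! ### Nisan pulled back to the promise -/

/-- For every completion `f` of `(D, P)`: `D(P on D) ≤ 27 · R₂(f)³`. [cite: Nisan1991]
[cite: Wolf2002, Cor 3] -/
theorem detQueryComplexityOn_le_of_mem_completions_rand {D : Set (Fin N → Bool)}
    {P f : (Fin N → Bool) → Bool} (hf : f ∈ completions D P) :
    detQueryComplexityOn D P ≤ 27 * randQueryComplexity (1 / 3) f ^ 3 := by
  rw [← detQueryComplexityOn_congr hf]
  exact (detQueryComplexityOn_le_detQueryComplexity D f).trans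
    (detQueryComplexity_le_27_mul_randQueryComplexity_pow_three f)

/-- **`D(P on D) ≤ 27 · psdR₂(D, P)³`**: classical pseudo-determinism saves at most a cube over
determinism, on any promise (Nisan's `D ≤ 27 R₂³` for the completion). [cite: Nisan1991]
[cite: Wolf2002, Cor 3] -/
theorem detQueryComplexityOn_le_psdRand_pow_three (D : Set (Fin N → Bool))
    (P : (Fin N → Bool) → Bool) :
    detQueryComplexityOn D P ≤ 27 * psdRandQueryComplexity (1 / 3) D P ^ 3 := by
  obtain ⟨f, hf, hq⟩ := exists_mem_completions_eq_psdRand (1 / 3) D P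
  rw [← hq]
  exact detQueryComplexityOn_le_of_mem_completions_rand hf

/-! ### Approximate majority, classically -/

/-- **`N < 81 · psdR₂(GapMaj_N)³`** (`1 ≤ N`): every pseudo-deterministic RANDOMISED algorithm for
approximate majority makes more than `(N/81)^{1/3}` queries — the decision form, with constant, of
Goldreich–Goldwasser–Ron's `Ω(N)` [GIPS2021 p. 36:18] (`N < 3·D(on promise) ≤ 81·psdR₂³`).
[cite: GIPS2021, p. 36:18] [cite: Nisan1991] -/
theorem gapMaj_lt_psdRand_pow_three (hN : 1 ≤ N) :
    N < 81 * psdRandQueryComplexity (1 / 3) (gapMajPromise N) (gapMajFn N) ^ 3 := by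
  have h1 := gapMaj_lt_three_mul_detQueryComplexityOn hN
  have h2 := detQueryComplexityOn_le_psdRand_pow_three (gapMajPromise N) (gapMajFn N)
  omega

/-- **The classical pseudo-determinism gap at approximate majority**: `R₂ ≤ 1` on the promise but
`81 · psdR₂³ > N`. [cite: GIPS2021, p. 36:18] [cite: Nisan1991] -/
theorem gapMaj_psdRand_gap (hN : 1 ≤ N) :
    randQueryComplexityOn (1 / 3) (gapMajPromise N) (gapMajFn N) ≤ 1 ∧
      N < 81 * psdRandQueryComplexity (1 / 3) (gapMajPromise N) (gapMajFn N) ^ 3 :=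
  ⟨gapMaj_randQueryComplexityOn_le_one hN, gapMaj_lt_psdRand_pow_three hN⟩

/-- **All three doors are black-box shut at one problem.** At approximate majority (`1 ≤ N`):
`R₂ ≤ 1` and `Q₂ ≤ 1` on the promise, while every classical canoniser costs `> (N/81)^{1/3}` and
every quantum canoniser `> (N/12288)^{1/6}` queries — the black-box shadows of C-EXT', H₀ and
Q-EXT fail together. [cite: GIPS2021, p. 36:18] [cite: Nisan1991] [cite: BealsEtAl2001, Thm 5.4] -/
theorem gapMaj_three_doors (hN : 1 ≤ N) :
    randQueryComplexityOn (1 / 3) (gapMajPromise N) (gapMajFn N) ≤ 1 ∧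
      quantumQueryComplexityOn (1 / 3) (gapMajPromise N) (gapMajFn N) ≤ 1 ∧
      N < 81 * psdRandQueryComplexity (1 / 3) (gapMajPromise N) (gapMajFn N) ^ 3 ∧
      N < 12288 * psdQuantumQueryComplexity (1 / 3) (gapMajPromise N) (gapMajFn N) ^ 6 :=
  ⟨gapMaj_randQueryComplexityOn_le_one hN, gapMaj_quantumQueryComplexityOn_le_one hN,
    gapMaj_lt_psdRand_pow_three hN, gapMaj_lt_psd_pow_six hN⟩

/-- **Pseudo-deterministic randomised query complexity is not polynomially bounded by randomised
query complexity on the promise**: no `C, k` give `psdR₂(D,P) ≤ C · R₂(P on D)ᵏ + C` (witness: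
approximate majority). [cite: GIPS2021, p. 36:18] [cite: Nisan1991] -/
theorem not_psdRandPolyBounded (C k : ℕ) :
    ¬ ∀ (N : ℕ) (D : Set (Fin N → Bool)) (P : (Fin N → Bool) → Bool),
      psdRandQueryComplexity (1 / 3) D P ≤ C * randQueryComplexityOn (1 / 3) D P ^ k + C := by
  intro h
  set N := 81 * (2 * C) ^ 3 + 1 with hNdef
  have hN : 1 ≤ N := by omega
  have hb := h N (gapMajPromise N) (gapMajFn N)
  have hR := gapMaj_randQueryComplexityOn_le_one hN
  have hlow := gapMaj_lt_psdRand_pow_three hN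
  set p := psdRandQueryComplexity (1 / 3) (gapMajPromise N) (gapMajFn N) with hp
  set r := randQueryComplexityOn (1 / 3) (gapMajPromise N) (gapMajFn N) with hr
  have hrk : r ^ k ≤ 1 := by
    calc r ^ k ≤ 1 ^ k := Nat.pow_le_pow_left hR k
      _ = 1 := one_pow k
  have hp2 : p ≤ 2 * C := by
    have : C * r ^ k ≤ C * 1 := Nat.mul_le_mul_left C hrk
    omega
  have hp3 : p ^ 3 ≤ (2 * C) ^ 3 := Nat.pow_le_pow_left hp2 3
  have : 81 * p ^ 3 ≤ 81 * (2 * C) ^ 3 := Nat.mul_le_mul_left _ hp3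
  omega

end Summit.QuantumAdvantage.QuantumAdvantage.Theorems

end
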